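import Summits.CriticalPhenomena.PercolationContinuityZ3.Theorems.PercNearOneGluingNoHeavyQuantFarSunWeakestBetAll
import Summits.CriticalPhenomena.PercolationContinuityZ3.Theorems.PercNearOneGluingNoHeavyQuantFarSunLayerTwoAllK
import HarnessLib

/-!
# FAR beyond trees: EVERY LAYER FOR ALL `K` — `SunFAR K j` (`j ≥ 2`, every `K ≥ 2`), conditionally on the single inequality (S-avg)_j

builds on p205010 (kernel theorem, internal audit signed; external expert review pending)

Support file (`--supports stmt-CriticalPhenomena-4575`), seat `prim-cert-1` (gen 41); memo `prim-cert-1/FROM-prim-cert-1-g41-ALL-LAYERS.md` §1–§2.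
The layer-two assembly `…QuantFarSunLayerTwoAllK` (gen 37: `HairyCycle.sunFAR_two_of_witGavg_from`) lifted to EVERY layer `j ≥ 2`, now that THM B
holds at every layer (`HairyCycle.hairCert_of_weakestBet_all`, `…QuantFarSunWeakestBetAll`): the universal-witness certificate with the averaged kernel
(`HairyCycle.sunFAR_of_hairCert_lowWitAvg`, valid whenever `G_avg = witGavg K h j ≥ 1`) and the weakest-hair bet (valid whenever `η(Σ − 2j) ≤ j(F − η)`)
reduce `SunFAR K j` for ALL `K` and ALL layers `j ≥ 2` to ONE explicit inequality family:

  **(S-avg)_j**: for `K ≥ K₁`, hair weights `h ∈ [0,1]` on `range K` with least weight `η = h m`, `Σ = Σ_{k<K} h k > 2j` and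
  `F = hairV K h j (range K)`:  `j(F − η) < η(Σ − 2j)  ⟹  witGavg K h j ≥ 1`.

Status of (S-avg)_j: at `j = 2` it is a KERNEL THEOREM for every `K ≥ 12` (gen 39, `…QuantFarSunLayerTwoAll`, vertex principle + delay-2 games) and
layer two holds for all `K` (`HairyCycle.sunFAR_two_all`); for `j ≥ 3` it is the open all-`K` target (numerics g34/g35: it holds for `K ≥ 4j+1`; in the
band `3j+1 ≤ K ≤ 4j` the two rules do not suffice and in `2j+1 ≤ K ≤ 3j` no hair-only certificate exists — memo §2).  The kernel has every `K ≤ 11`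
at every layer (`HairyCycle.sunFAR_of_le_eleven`, `…QuantFarSunRowLeEleven`).

* **`HairyCycle.sunFAR_of_witGavg_from_all`** — `(S-avg)_j from K₁ on → ∀ K ≥ K₁, SunFAR K j` (`K₁ ≥ 2`, `j ≥ 2`);
* **`HairyCycle.sunFAR_of_witGavg_all`** — `(S-avg)_j from 11 on → ∀ K ≥ 2, SunFAR K j` (the `K ≤ 10` part by `HairyCycle.sunFAR_of_le_ten`).
No definitions, no sorries, standard axioms.  [this work]
[cite: KozmaNitzan2024, Conjecture 3 (p. 15)] (context: the lower-tail family FAR serves).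
-/

noncomputable section

namespace Summit.CriticalPhenomena.PercolationContinuityZ3.Theorems.HairyCycle

open Finset
open scoped Classical

/-- **LAYER `j ≥ 2` FROM `K₁` ON, CONDITIONALLY ON (S-avg)_j FROM `K₁` ON** (`K₁ ≥ 2`).  If for every `K ≥ K₁` and every `h ∈ [0,1]` on `range K`
with least weight `η = h m` (`m < K`) and `Σ_{k<K} h k > 2j` the strict inequality `j(F − η) < η(Σ − 2j)` (`F = hairV K h j (range K)`) forces
`witGavg K h j ≥ 1`, then `SunFAR K j` holds for every `K ≥ K₁`: by `sunFAR_of_hairCert_lowWitAvg`, the regime `witGavg < 1` being covered by THM B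
at layer `j` (`hairCert_of_weakestBet_all`) since there `η(Σ − 2j) ≤ j(F − η)` by hypothesis. [this work] -/
theorem sunFAR_of_witGavg_from_all {j : ℕ} (hj : 2 ≤ j) (K₁ : ℕ) (hK₁ : 2 ≤ K₁)
    (hS : ∀ K : ℕ, K₁ ≤ K → ∀ h : ℕ → ℝ, (∀ k, k < K → 0 ≤ h k ∧ h k ≤ 1) → ∀ m : ℕ, m < K → (∀ k, k < K → h m ≤ h k) →
      (2 * j : ℝ) < ∑ k ∈ range K, h k → j * (hairV K h j (range K) - h m) < h m * (∑ k ∈ range K, h k - 2 * j) →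
      1 ≤ witGavg K h j) :
    ∀ K : ℕ, K₁ ≤ K → SunFAR K j := by
  intro K hK
  have hK2 : 2 ≤ K := le_trans hK₁ hK
  refine sunFAR_of_hairCert_lowWitAvg hK2 fun g h hg hh hEN hGlt => ?_
  -- `Σ h > 2j`
  have hS2j : (2 * j : ℝ) < ∑ k ∈ range K, h k := by
    have h1 : ∑ k ∈ range K, sunMarg K g h k ≤ ∑ k ∈ range K, h k :=
      Finset.sum_le_sum fun k hk => sunMarg_le_h hK2 hg (Finset.mem_range.1 hk) (hh k (Finset.mem_range.1 hk)).1
    linarith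
  -- a least weight
  obtain ⟨m, hmK, hmin⟩ := Finset.exists_min_image (range K) h ⟨0, Finset.mem_range.2 (by omega)⟩
  have hm : m < K := Finset.mem_range.1 hmK
  have hmin' : ∀ k, k < K → h m ≤ h k := fun k hk => hmin k (Finset.mem_range.2 hk)
  -- in the regime `R_j` the averaged witness weight would be `≥ 1`: contradiction; so THM B's hypothesis holds
  have hB : h m * (∑ k ∈ range K, h k - 2 * j) ≤ j * (hairV K h j (range K) - h m) := by
    by_contra hR
    push Not at hR
    exact absurd (hS K hK h hh m hm hmin' hS2j hR) (not_le.2 hGlt)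
  -- truncate `h` outside `range K` and apply THM B
  set h' : ℕ → ℝ := fun k => if k < K then h k else 0 with hh'def
  have he : ∀ k, k < K → h' k = h k := fun k hk => by rw [hh'def]; simp only [hk, if_true]
  have hh' : ∀ k, 0 ≤ h' k ∧ h' k ≤ 1 := by
    intro k
    by_cases hk : k < K
    · rw [he k hk]; exact hh k hk
    · rw [hh'def]; simp only [hk, if_false]; norm_num
  have hsum : ∑ k ∈ range K, h' k = ∑ k ∈ range K, h k :=
    Finset.sum_congr rfl fun k hk => he k (Finset.mem_range.1 hk)
  have hF : hairV K h' j (range K) = hairV K h j (range K) := hairV_congr he j (range K)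
  obtain ⟨lam, μ, hlam, hlam1, hμ, hrows⟩ := hairCert_of_weakestBet_all (K := K) hh' hj (by rw [hsum]; exact hS2j) hm
    (fun k hk => by rw [he m hm, he k hk]; exact hmin' k hk) (by rw [hsum, hF, he m hm]; exact hB)
  refine ⟨lam, μ, hlam, hlam1, hμ, fun p hp => ?_⟩
  have hr := hrows p hp
  rw [hairV_congr he j, sum_cov_congr he (fun k x => lam k * x), sum_cov_congr he (fun _ x => x)] at hr
  exact hr

/-- **EVERY LAYER FOR ALL `K`, CONDITIONALLY ON (S-avg)_j.**  If `j ≥ 2` and for every `K ≥ 11` and every `h ∈ [0,1]` on `range K` with least weight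
`η = h m` (`m < K`) and `Σ > 2j` the strict inequality `j(F − η) < η(Σ_{k<K} h k − 2j)` forces `witGavg K h j ≥ 1`, then `SunFAR K j` holds for every
`K ≥ 2`:  `K ≤ 10` by the sun certificates (`sunFAR_of_le_ten`), `K ≥ 11` by `sunFAR_of_witGavg_from_all`. [this work] -/
theorem sunFAR_of_witGavg_all {j : ℕ} (hj : 2 ≤ j)
    (hS : ∀ K : ℕ, 11 ≤ K → ∀ h : ℕ → ℝ, (∀ k, k < K → 0 ≤ h k ∧ h k ≤ 1) → ∀ m : ℕ, m < K → (∀ k, k < K → h m ≤ h k) →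
      (2 * j : ℝ) < ∑ k ∈ range K, h k → j * (hairV K h j (range K) - h m) < h m * (∑ k ∈ range K, h k - 2 * j) →
      1 ≤ witGavg K h j) :
    ∀ K : ℕ, 2 ≤ K → SunFAR K j := by
  intro K hK2
  by_cases hK10 : K ≤ 10
  · exact sunFAR_of_le_ten hK2 hK10 j
  · exact sunFAR_of_witGavg_from_all hj 11 (by norm_num) hS K (by omega)

end Summit.CriticalPhenomena.PercolationContinuityZ3.Theorems.HairyCycle

end
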